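import Summits.BirchSwinnertonDyer.BirchSwinnertonDyer.Theorems.Rank2ObservatoryAnomHeightFreeBounds
import HarnessLib

/-!
# BirchSwinnertonDyer — rank-2 `Ш[p^∞]` cell: the EXACT VALUATION `ord_p [T^r] L_p(E,T)` from a
# kernel-checked symbol certificate (the `a` of the row theorem)

HONEST FRAMING (cell `b2b-bsdr2sha`, run/shared/lean/b2b/bsd-rank2-sha/): per-pair certified
theorems «cited hypotheses ∧ certified computation ⇒ `Ш(E/ℚ)[p^∞]` finite of order `p^k`» for
rank-2 curves at good ordinary primes; NO claim on BSD in rank `≥ 2`, no class-level theorem, every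
published input is a NAMED HYPOTHESIS of the tree (nothing is asserted or minted here).

The observatory's symbol-table certificate (`Rank2ObservatoryPadicSymbolTableL.lean`: a level-`p^{n+1}`
table of plus modular symbols, an integer `A ≡ α (mod p^n)` certified by `p^n ∣ A² − a_p A + p`, the
double sums `H = ΣHi`, `L = ΣLo`) gives `[T^r] L_p ≠ 0` when `p^n ∤ A·H − L`
(`coeff_ne_zero_of_symbolCertL`) and `‖[T^r] L_p‖ = 1` when `p ∤ A·H − L`
(`norm_coeff_eq_one_of_symbolCertL`, `Rank2ObservatoryAnomHeightFreeBounds.lean` §3). The exact-order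
row theorem of this cell (`Rank2ShaOrderRow.lean`, exponent `k = a + r − 2·ord_p #Ẽ(𝔽_p) − ord_p ∏c_ℓ − b`)
needs the VALUE `a = ord_p [T^r] L_p` at every cell, unit or not (Stein–Wuthrich's running example
`446d1` at `p = 5` has `[T²] L_5 = 5 + 5² + 3·5³ + O(5⁴)`, `a = 1`). This file proves the general
statement behind both: with `v = ord_p(A·H − L) < n`,

  `‖[T^r] L_p(f, α, T)‖ = p^{−v}`,  i.e.  `ord_p [T^r] L_p = ord_p(A·H − L)`,

because `RS(r, n) = α^{−(n+2)} D^{−1} (αH − L)` (`padicLRiemannSum_eq_isumL`), `‖α − A‖ ≤ p^{−n}`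
(`norm_unitRoot_sub_int_le`) so `‖αH − L‖ = ‖AH − L‖ = p^{−v}` (ultrametric, `v < n`), and the
truncation error `‖[T^r] L_p − RS(r, n)‖ ≤ p^{−n}/‖r!‖ = p^{−n} < p^{−v}` (`norm_padicLCoeff_eq_of_lt`,
Mazur–Tate–Teitelbaum §I.11–I.13, measure bound `C = 1` from `p`-integrality of the plus symbols).

* `norm_coeff_eq_zpow_of_symbolTableL` — the statement above with explicit data;
* `norm_coeff_eq_zpow_of_symbolCertL`, `valuation_coeff_eq_of_symbolCertL` — from a VALID
  `SymbolCertL` (`validL`, which contains `p^n ∤ A·H − L`, i.e. `v < n`):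
  `ord_p [T^{c.r}] L_p = padicValInt p (c.A·c.H − c.L)` — a kernel integer.

References: B. Mazur, J. Tate, J. Teitelbaum, Invent. Math. 84 (1986), §I.10–I.13
[MazurTateTeitelbaum1986Invent]; W. Stein, C. Wuthrich, Math. Comp. 82 (2013), §3 (Prop. 3.5, the
running example (3.3)) [SteinWuthrich2013].
-/

set_option autoImplicit false

-- single-conjunct summit: `Summit.BirchSwinnertonDyer.BirchSwinnertonDyer.…` repeats the name by design
set_option linter.dupNamespace false

noncomputable section

open scoped Classical MatrixGroups ModularForm

open CongruenceSubgroup WeierstrassCurve Literature.NumberTheory.EllipticCurves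
  Literature.NumberTheory.EllipticCurves.ModularForms
  Summit.BirchSwinnertonDyer.BirchSwinnertonDyer.Rank2Observatory

namespace Summit.BirchSwinnertonDyer.BirchSwinnertonDyer.Rank2Sha

variable (p : ℕ) [Fact p.Prime]

/-- The norm of a non-zero integer in `ℚ_p` is `p^{−ord_p}`. [folklore] -/
theorem norm_intCast_eq_zpow_neg_padicValInt {z : ℤ} (hz : z ≠ 0) :
    ‖(z : ℚ_[p])‖ = (p : ℝ) ^ (-(padicValInt p z : ℤ)) := by
  have hz' : (z : ℚ_[p]) ≠ 0 := by exact_mod_cast hz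
  rw [Padic.norm_eq_zpow_neg_valuation hz', Padic.valuation_intCast]

/-- **`‖[T^r] L_p‖ = p^{−v}` from a level-`p^{n+1}` symbol table, the digits of `α`, and
`v = ord_p(A·ΣHi − ΣLo) < n`** (odd good ordinary `p`, `p ∤ r!`): with `A ≡ α (mod p^n)` and
`v < n`, `‖RS(r, n)‖ = ‖α ΣHi − ΣLo‖ = ‖A ΣHi − ΣLo‖ = p^{−v} > p^{−n} ≥` the truncation error, so
`‖[T^r] L_p‖ = ‖RS(r, n)‖ = p^{−v}` (`norm_padicLCoeff_eq_of_lt`). Same data as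
`coeff_ne_zero_of_symbolTableL`; the unit case `v = 0` is `norm_coeff_eq_one_of_symbolTableL`.
[cite: MazurTateTeitelbaum1986Invent, §I.10–I.13] [cite: SteinWuthrich2013, §3 Prop. 3.5] -/
theorem norm_coeff_eq_zpow_of_symbolTableL (hp2 : p ≠ 2) (W : WeierstrassCurve ℚ) [W.IsElliptic]
    [W.IsGloballyMinimal] {N : ℕ} [NeZero N] {f : CuspForm (Gamma0 N) 2}
    (hord : IsOrdinaryAt W p) (hf : IsNewformOf W f) {r : ℕ} (hr : ¬ p ∣ r.factorial) (n : ℕ)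
    (tabHi tabLo : List ℤ) (D : ℚ) (hD : ‖(D : ℚ_[p])‖ = 1) (H L A : ℤ)
    (hA : (p : ℤ) ^ n ∣ A ^ 2 - W.frobeniusTrace p * A + p) (hAu : ¬ (p : ℤ) ∣ A)
    {v : ℕ} (hv : padicValInt p (A * H - L) = v) (hvn : v < n) (hHL0 : A * H - L ≠ 0)
    (hcard : (teichSet p (n + 1)).card = torsionOrder p)
    (hunit : ∀ y ∈ teichSet p (n + 1), ∀ s : ZMod (p ^ n),
      ¬ p ∣ (y * ((1 + p : ℕ) : ZMod (p ^ (n + 1))) ^ s.val).val)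
    (hHi : isumL p n tabHi r = H) (hLo : isumL p n tabLo r = L)
    (hint : ∀ x : ℚ, ‖(ratPlusSymbol f x : ℚ_[p])‖ ≤ 1)
    (htab : ∀ u : ℕ, u < p ^ (n + 1) → ¬ p ∣ u →
      ratPlusSymbol f ((u : ℚ) / (p : ℚ) ^ (n + 1)) = (tabHi.getD u 0 : ℚ) / D ∧
      ratPlusSymbol f ((u : ℚ) / (p : ℚ) ^ n) = (tabLo.getD u 0 : ℚ) / D) :
    ‖PowerSeries.coeff r (padicLFunction f (unitRoot W p : ℚ_[p]))‖ = (p : ℝ) ^ (-(v : ℤ)) := by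
  have hpP : p.Prime := Fact.out
  have hp1 : (1 : ℝ) < p := by exact_mod_cast hpP.one_lt
  have hα : ‖(unitRoot W p : ℚ_[p])‖ = 1 := norm_unitRoot_holds W p hord
  have hαA := norm_unitRoot_sub_int_le p W hord A n hA hAu
  set α : ℚ_[p] := (unitRoot W p : ℚ_[p]) with hαdef
  have hα0 : α ≠ 0 := fun h => by rw [h, norm_zero] at hα; exact zero_ne_one hα
  have hD0 : (D : ℚ_[p]) ≠ 0 := fun h => by rw [h, norm_zero] at hD; exact zero_ne_one hD
  -- `‖A·H − L‖ = p^{-v}`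
  have h1 : ‖(((A * H - L : ℤ)) : ℚ_[p])‖ = (p : ℝ) ^ (-(v : ℤ)) := by
    rw [norm_intCast_eq_zpow_neg_padicValInt p hHL0, hv]
  -- `‖RS(r, n)‖ = p^{-v}`
  have hRS : ‖padicLRiemannSum f α r n‖ = (p : ℝ) ^ (-(v : ℤ)) := by
    rw [padicLRiemannSum_eq_isumL p f _ r n hp2 tabHi tabLo D hcard hunit htab, hHi, hLo]
    have hαinv : α⁻¹ * α = 1 := inv_mul_cancel₀ hα0
    have hfactor : α⁻¹ ^ (n + 1) * ((((H : ℤ) : ℚ) / D : ℚ) : ℚ_[p]) -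
        α⁻¹ ^ (n + 2) * ((((L : ℤ) : ℚ) / D : ℚ) : ℚ_[p]) =
          α⁻¹ ^ (n + 2) * ((D : ℚ_[p]))⁻¹ * (α * H - L) := by
      push_cast [Rat.cast_div]
      rw [div_eq_mul_inv, div_eq_mul_inv]
      linear_combination (-(α⁻¹ ^ (n + 1) * ((H : ℤ) : ℚ_[p]) * ((D : ℚ_[p]))⁻¹)) * hαinv
    rw [hfactor, norm_mul, norm_mul, norm_pow, norm_inv, hα, inv_one, one_pow, one_mul, norm_inv, hD,
      inv_one, one_mul]
    have h2 : ‖(α - A) * (H : ℚ_[p])‖ < (p : ℝ) ^ (-(v : ℤ)) := by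
      rw [norm_mul]
      calc ‖α - A‖ * ‖((H : ℤ) : ℚ_[p])‖ ≤ (p : ℝ) ^ (-(n : ℤ)) * 1 :=
            mul_le_mul hαA (Padic.norm_int_le_one H) (norm_nonneg _)
              (zpow_nonneg (Nat.cast_nonneg _) _)
        _ < (p : ℝ) ^ (-(v : ℤ)) := by
            rw [mul_one]; exact zpow_lt_zpow_right₀ hp1 (by omega)
    have hsplit : α * H - L = (((A * H - L : ℤ)) : ℚ_[p]) + (α - A) * H := by push_cast; ring
    rw [hsplit, Padic.add_eq_max_of_ne (by rw [h1]; exact h2.ne'), h1, max_eq_left h2.le]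
  -- the truncation error `p^{-n} < p^{-v} = ‖RS‖`
  have hfac : ‖((r.factorial : ℕ) : ℚ_[p])‖ = 1 := by
    rw [Padic.norm_natCast_eq_one_iff]
    exact (Nat.Prime.coprime_iff_not_dvd Fact.out).mpr hr
  have hC := norm_msdMeasure_le_one p f α hα hint
  have hlt : (1 : ℝ) / ‖((r.factorial : ℕ) : ℚ_[p])‖ * (p : ℝ) ^ (-n : ℤ) <
      ‖padicLRiemannSum f α r n‖ := by
    rw [hfac, div_one, one_mul, hRS]
    exact zpow_lt_zpow_right₀ hp1 (by omega)
  rw [coeff_padicLFunction, (norm_padicLCoeff_eq_of_lt (msdMeasure_distribution_of_isNewformOf hord hf)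
    ((norm_nonneg _).trans (hC 0 0)) hC hlt).1, hRS]

/-- **`‖[T^r] L_p‖ = p^{−ord_p(A·H − L)}` from a VALID `SymbolCertL`** (`validL p a_p`: its conjunct
`p^n ∤ A·H − L` gives both `A·H − L ≠ 0` and `ord_p(A·H − L) < n`; `hap` identifies the Frobenius trace
used for `A`). [cite: MazurTateTeitelbaum1986Invent, §I.10–I.13] [cite: SteinWuthrich2013, §3 Prop. 3.5] -/
theorem norm_coeff_eq_zpow_of_symbolCertL (W : WeierstrassCurve ℚ) [W.IsElliptic] [W.IsGloballyMinimal]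
    {N : ℕ} [NeZero N] {f : CuspForm (Gamma0 N) 2} (hord : IsOrdinaryAt W p) (hf : IsNewformOf W f)
    {ap : ℤ} (hap : W.frobeniusTrace p = ap) (c : SymbolCertL) (hc : c.validL p ap = true) (D : ℚ)
    (hD : ‖(D : ℚ_[p])‖ = 1) (hint : ∀ x : ℚ, ‖(ratPlusSymbol f x : ℚ_[p])‖ ≤ 1)
    (htab : ∀ u : ℕ, u < p ^ (c.n + 1) → ¬ p ∣ u →
      ratPlusSymbol f ((u : ℚ) / (p : ℚ) ^ (c.n + 1)) = (c.tabHi.getD u 0 : ℚ) / D ∧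
      ratPlusSymbol f ((u : ℚ) / (p : ℚ) ^ c.n) = (c.tabLo.getD u 0 : ℚ) / D) :
    ‖PowerSeries.coeff c.r (padicLFunction f (unitRoot W p : ℚ_[p]))‖ =
      (p : ℝ) ^ (-(padicValInt p (c.A * c.H - c.L) : ℤ)) := by
  obtain ⟨hp2, hr, hA, hAu, hHL, hcard, hunit, hHi, hLo⟩ := of_decide_eq_true hc
  have hHL0 : c.A * c.H - c.L ≠ 0 := fun h0 => hHL (by rw [h0]; exact dvd_zero _)
  have hvn : padicValInt p (c.A * c.H - c.L) < c.n := by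
    by_contra hle
    exact hHL ((padicValInt_dvd_iff c.n _).mpr (Or.inr (not_lt.mp hle)))
  rw [← hap] at hA
  exact norm_coeff_eq_zpow_of_symbolTableL p hp2 W hord hf hr c.n c.tabHi c.tabLo D hD c.H c.L c.A hA
    hAu rfl hvn hHL0 hcard hunit hHi hLo hint htab

/-- **`ord_p [T^r] L_p = ord_p(A·H − L)` and `[T^r] L_p ≠ 0` from a VALID `SymbolCertL`** — the
valuation form consumed by the row theorems of `Rank2ShaOrderRow.lean` (hypotheses `hLp`, `hcoeff`
with `a = padicValInt p (c.A·c.H − c.L)`, a kernel integer).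
[cite: MazurTateTeitelbaum1986Invent, §I.10–I.13] [cite: SteinWuthrich2013, §3 Prop. 3.5] -/
theorem valuation_coeff_eq_of_symbolCertL (W : WeierstrassCurve ℚ) [W.IsElliptic] [W.IsGloballyMinimal]
    {N : ℕ} [NeZero N] {f : CuspForm (Gamma0 N) 2} (hord : IsOrdinaryAt W p) (hf : IsNewformOf W f)
    {ap : ℤ} (hap : W.frobeniusTrace p = ap) (c : SymbolCertL) (hc : c.validL p ap = true) (D : ℚ)
    (hD : ‖(D : ℚ_[p])‖ = 1) (hint : ∀ x : ℚ, ‖(ratPlusSymbol f x : ℚ_[p])‖ ≤ 1)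
    (htab : ∀ u : ℕ, u < p ^ (c.n + 1) → ¬ p ∣ u →
      ratPlusSymbol f ((u : ℚ) / (p : ℚ) ^ (c.n + 1)) = (c.tabHi.getD u 0 : ℚ) / D ∧
      ratPlusSymbol f ((u : ℚ) / (p : ℚ) ^ c.n) = (c.tabLo.getD u 0 : ℚ) / D) :
    PowerSeries.coeff c.r (padicLFunction f (unitRoot W p : ℚ_[p])) ≠ 0 ∧
      (PowerSeries.coeff c.r (padicLFunction f (unitRoot W p : ℚ_[p]))).valuation =
        padicValInt p (c.A * c.H - c.L) := by
  have hp1 : (1 : ℝ) < p := by exact_mod_cast (Fact.out : p.Prime).one_lt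
  have hnorm := norm_coeff_eq_zpow_of_symbolCertL p W hord hf hap c hc D hD hint htab
  have hne : PowerSeries.coeff c.r (padicLFunction f (unitRoot W p : ℚ_[p])) ≠ 0 := fun h0 => by
    rw [h0, norm_zero] at hnorm
    exact (zpow_pos (zero_lt_one.trans hp1) _).ne hnorm
  exact ⟨hne, valuation_eq_of_norm_eq hne hnorm⟩

end Summit.BirchSwinnertonDyer.BirchSwinnertonDyer.Rank2Sha

end
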